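/- Width seat 2/3 `ym-line-cbag-p1-w2` (prover-ym-line-cbag-p1-w2-g20-0) of the cell of ideator ym-idea-2, LINE 8
(route `EguchiKawaiDirectionLadder`), post-closure glue toward the STRONG-COUPLING side of the barrier entry
`EguchiKawaiBreakdown`: the Bakry–Émery curvature of the QUADRATIC one-link tilts `Σᵢ cᵢ Re tr(Q Aᵢ Qᴴ Cᵢ)` of the
Eguchi–Kawai single-site model (each link enters each reduced plaquette twice).  Route-independent; YM mass gap NOT touched
(barrier-ledger line). -/
import Literature.MathematicalPhysics.QuantumFieldTheory.SUNBakryEmeryPoincare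
import HarnessLib

/-!
# Bakry–Émery curvature of quadratic one-link tilts `Q ↦ Σᵢ cᵢ Re tr(Q Aᵢ Qᴴ Cᵢ)` on `U(N)`

In the Eguchi–Kawai single-site model the conditional law of one link `Q = U_μ` given the others is the Haar tilt
`exp(S) dσ` with `S(Q) = (N b/2) Σ_{ν ≠ μ} [Re tr(Q U_ν† Qᴴ U_ν) + Re tr(Q U_ν Qᴴ U_ν†)]` — QUADRATIC in `Q` (the tree's
`SUNBakryEmery.Gam2_potential_ge` treats the LINEAR tilt `c Re tr(Q B)` of lattice Yang–Mills, where each link enters each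
plaquette once).  This file computes, in the tree's left-invariant frame calculus (`matD`, `Gam`, `Gam2`, `frame`, `frameGrad`):

* `matD_reTrQuad` : `D_Y Re tr(Q A Qᴴ C) = Re tr(Q Y A Qᴴ C) + Re tr(Q A Yᴴ Qᴴ C)`; for skew `Y` this is
  `Re tr(Q [Y, A] Qᴴ C)` (`matD_reTrQuad_of_skew`) — the derivative of a quadratic tilt is a quadratic tilt;
* `sum_sum_hess_reTrQuad` : the frame Hessian form `Σ_{αβ} D_α u D_β u D_α D_β Re tr(Q A Qᴴ C)
  = Re tr(Q Z²A Qᴴ C) − 2 Re tr(Q Z A Z Qᴴ C) + Re tr(Q A Z² Qᴴ C)`, `Z = ∇u(Q) ∈ 𝔰𝔲(N)`;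
* `abs_sum_sum_hess_reTrQuad_le` : for unitary `Q, A, C` it is bounded by `4 Γ(u,u)(Q)` (unitary invariance of `‖·‖_F` and
  `|Re tr(X Y)| ≤ ‖X‖_F ‖Y‖_F`);
* `Gam2_quadTilt_ge` : **`Γ₂^S(u) ≥ (N/2 − 4 Σᵢ |cᵢ|) Γ(u,u)` on `U(N)`** for `S = Σᵢ cᵢ Re tr(Q Aᵢ Qᴴ Cᵢ)` with `Aᵢ, Cᵢ`
  unitary (`Ric_{SU(N)} = N/2`, tree `sum_sum_sq_comm_matD`, plus the Hessian bound) — the hypothesis `hCD` of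
  `…PolyTiltPoincare.poincare_of_cd` with `K = N/2 − 4 Σᵢ |cᵢ|`.

References: Bakry–Émery (1985); Shen–Zhu–Zhu, CMP 400 (2023) Lemma 4.1, (4.7)–(4.8) (the linear case); Makeenko, *Methods of
contemporary gauge theory*, (14.38)–(14.40) (the reduced action).  HONEST FRAMING: a curvature computation; no statement about
Yang–Mills, no mass gap, no summit statement is proved or advanced here.
-/

set_option autoImplicit false

noncomputable section

open scoped Matrix Matrix.Norms.Frobenius ContDiff Topology
open MeasureTheory Filter Finset Matrix
open Literature.MathematicalPhysics.QuantumFieldTheory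
open Literature.MathematicalPhysics.QuantumFieldTheory.SUNBakryEmery

namespace Summit.QuantumFields.YangMills.Theorems.EguchiKawaiDirectionLadder

variable {N : ℕ}

/-! ## The left-invariant derivative of `Q ↦ Re tr(Q A Qᴴ C)` -/

/-- `Q ↦ Qᴴ` is a bounded real linear map of `M_N(ℂ)` (Frobenius norm; `‖Qᴴ‖_F = ‖Q‖_F`). -/
theorem isBoundedLinearMap_conjTranspose :
    IsBoundedLinearMap ℝ fun Q : Matrix (Fin N) (Fin N) ℂ => Qᴴ := by
  refine ⟨⟨fun Q Q' => conjTranspose_add Q Q', fun r Q => ?_⟩, 1, one_pos, fun Q => ?_⟩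
  · ext i j
    simp [conjTranspose_apply, Matrix.smul_apply]
  · rw [one_mul]
    exact (Matrix.frobenius_norm_conjTranspose Q).le

/-- `Q ↦ Qᴴ` is smooth (it is real linear). -/
theorem contDiff_conjTranspose : ContDiff ℝ ∞ fun Q : Matrix (Fin N) (Fin N) ℂ => Qᴴ :=
  isBoundedLinearMap_conjTranspose.contDiff

/-- `Q ↦ Q A Qᴴ` is smooth. -/
theorem contDiff_mul_mul_conjTranspose (A : Matrix (Fin N) (Fin N) ℂ) :
    ContDiff ℝ ∞ fun Q : Matrix (Fin N) (Fin N) ℂ => Q * A * Qᴴ :=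
  (contDiff_id.mul contDiff_const).mul contDiff_conjTranspose

/-- **The quadratic tilt `Q ↦ Re tr(Q A Qᴴ C)` is smooth.** -/
theorem contDiff_reTrQuad (A C : Matrix (Fin N) (Fin N) ℂ) :
    ContDiff ℝ ∞ fun Q : Matrix (Fin N) (Fin N) ℂ => (Q * A * Qᴴ * C).trace.re := by
  have : (fun Q : Matrix (Fin N) (Fin N) ℂ => (Q * A * Qᴴ * C).trace.re) = fun Q => reTrMul C (Q * A * Qᴴ) := by
    funext Q; rw [reTrMul_apply]
  rw [this]
  exact (reTrMul C).contDiff.comp (contDiff_mul_mul_conjTranspose A)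

/-- Smoothness of `Q ↦ c Re tr(Q A Qᴴ C)`. -/
theorem contDiff_const_mul_reTrQuad (c : ℝ) (A C : Matrix (Fin N) (Fin N) ℂ) :
    ContDiff ℝ ∞ fun Q : Matrix (Fin N) (Fin N) ℂ => c * (Q * A * Qᴴ * C).trace.re :=
  contDiff_const.mul (contDiff_reTrQuad A C)

/-- Smoothness of a finite sum of quadratic tilts `Q ↦ Σᵢ cᵢ Re tr(Q Aᵢ Qᴴ Cᵢ)`. -/
theorem contDiff_sum_reTrQuad {ι : Type*} (s : Finset ι) (c : ι → ℝ) (A C : ι → Matrix (Fin N) (Fin N) ℂ) :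
    ContDiff ℝ ∞ fun Q : Matrix (Fin N) (Fin N) ℂ => ∑ i ∈ s, c i * (Q * A i * Qᴴ * C i).trace.re :=
  ContDiff.sum fun i _ => contDiff_const_mul_reTrQuad (c i) (A i) (C i)

/-- **The left-invariant derivative of the quadratic tilt**:
`D_Y Re tr(Q A Qᴴ C) = Re tr(Q Y A Qᴴ C) + Re tr(Q A Yᴴ Qᴴ C)` (product rule; `d(Qᴴ)[H] = Hᴴ`). -/
theorem matD_reTrQuad (Y A C : Matrix (Fin N) (Fin N) ℂ) :
    matD Y (fun Q => (Q * A * Qᴴ * C).trace.re) =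
      fun Q => (Q * Y * A * Qᴴ * C).trace.re + (Q * A * Yᴴ * Qᴴ * C).trace.re := by
  have hlin := isBoundedLinearMap_conjTranspose (N := N)
  have hT : ∀ H : Matrix (Fin N) (Fin N) ℂ,
      IsBoundedLinearMap.toContinuousLinearMap (fun Q : Matrix (Fin N) (Fin N) ℂ => Qᴴ) hlin H = Hᴴ := fun H => rfl
  funext Q
  have ha : HasFDerivAt (fun Q : Matrix (Fin N) (Fin N) ℂ => Q * A)
      (ContinuousLinearMap.mulLeftRight ℝ (Matrix (Fin N) (Fin N) ℂ) 1 A) Q := hasFDerivAt_mul_const A Q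
  have hb : HasFDerivAt (fun Q : Matrix (Fin N) (Fin N) ℂ => Qᴴ)
      (IsBoundedLinearMap.toContinuousLinearMap (fun Q : Matrix (Fin N) (Fin N) ℂ => Qᴴ) hlin) Q := hlin.hasFDerivAt
  have hP := ha.mul' hb
  have hF := (reTrMul C).hasFDerivAt.comp Q hP
  have e : (fun Q : Matrix (Fin N) (Fin N) ℂ => (Q * A * Qᴴ * C).trace.re) =
      (⇑(reTrMul C)) ∘ ((fun Q : Matrix (Fin N) (Fin N) ℂ => Q * A) * fun Q : Matrix (Fin N) (Fin N) ℂ => Qᴴ) := by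
    funext Q; simp only [Function.comp_apply, Pi.mul_apply, reTrMul_apply]
  rw [matD_apply, e, hF.fderiv]
  simp only [ContinuousLinearMap.comp_apply, FunLike.coe_add, FunLike.coe_smul, Pi.add_apply, Pi.smul_apply,
    ContinuousLinearMap.mulLeftRight_apply, reTrMul_apply, smul_eq_mul, op_smul_eq_mul, one_mul,
    Matrix.add_mul, trace_add, Complex.add_re, Matrix.mul_assoc]
  rw [hT (Q * Y), conjTranspose_mul]
  simp only [Matrix.mul_assoc]
  ring

/-- For a skew direction `Y` (`Yᴴ = −Y`): `D_Y Re tr(Q A Qᴴ C) = Re tr(Q (Y A − A Y) Qᴴ C)` — again a quadratic tilt, with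
`A` replaced by the commutator `[Y, A]`. -/
theorem matD_reTrQuad_of_skew {Y : Matrix (Fin N) (Fin N) ℂ} (hY : Yᴴ = -Y) (A C : Matrix (Fin N) (Fin N) ℂ) :
    matD Y (fun Q => (Q * A * Qᴴ * C).trace.re) = fun Q => (Q * (Y * A - A * Y) * Qᴴ * C).trace.re := by
  rw [matD_reTrQuad]
  funext Q
  rw [hY]
  simp only [Matrix.mul_sub, Matrix.sub_mul, Matrix.mul_neg, Matrix.neg_mul, trace_sub, trace_neg, Complex.sub_re,
    Complex.neg_re, Matrix.mul_assoc]
  ring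

/-- The frame derivative of a quadratic tilt: `D_α Re tr(Q A Qᴴ C) = Re tr(Q [Y_α, A] Qᴴ C)`. -/
theorem matD_frame_reTrQuad (α : FrameIdx N) (A C : Matrix (Fin N) (Fin N) ℂ) :
    matD (frame α) (fun Q => (Q * A * Qᴴ * C).trace.re) =
      fun Q => (Q * (frame α * A - A * frame α) * Qᴴ * C).trace.re :=
  matD_reTrQuad_of_skew (frame_conjTranspose α) A C

/-- **The frame Hessian of a quadratic tilt**: `D_α D_β Re tr(Q A Qᴴ C) = Re tr(Q [Y_α, [Y_β, A]] Qᴴ C)`. -/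
theorem matD_matD_frame_reTrQuad (α β : FrameIdx N) (A C : Matrix (Fin N) (Fin N) ℂ) :
    matD (frame α) (matD (frame β) (fun Q => (Q * A * Qᴴ * C).trace.re)) =
      fun Q => (Q * (frame α * (frame β * A - A * frame β) - (frame β * A - A * frame β) * frame α) * Qᴴ * C).trace.re := by
  rw [matD_frame_reTrQuad β A C, matD_frame_reTrQuad α (frame β * A - A * frame β) C]

/-! ## The Hessian quadratic form and its bound -/

/-- `Σ_{αβ} a_α a_β Re tr(P Y_α M Y_β R) = Re tr(P Z M Z R)`, `Z = Σ a_α Y_α` (bilinear expansion with a middle factor; the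
tree's `sum_sum_mul_mul_re_trace` is `M = 1`). -/
theorem sum_sum_mul_mul_re_trace_mid (a : FrameIdx N → ℝ) (P M R : Matrix (Fin N) (Fin N) ℂ) :
    ∑ α, ∑ β, a α * a β * (P * frame α * M * frame β * R).trace.re =
      (P * (∑ α, a α • frame α) * M * (∑ α, a α • frame α) * R).trace.re := by
  simp only [Matrix.sum_mul, Matrix.mul_smul, Matrix.smul_mul, trace_sum, trace_smul,
    Complex.re_sum, Complex.smul_re, smul_eq_mul, Finset.mul_sum]
  rw [sum_comm]
  refine sum_congr rfl fun α _ => sum_congr rfl fun β _ => ?_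
  ring

/-- The same with `α` and `β` exchanged inside the trace. -/
theorem sum_sum_mul_mul_re_trace_mid' (a : FrameIdx N → ℝ) (P M R : Matrix (Fin N) (Fin N) ℂ) :
    ∑ α, ∑ β, a α * a β * (P * frame β * M * frame α * R).trace.re =
      (P * (∑ α, a α • frame α) * M * (∑ α, a α • frame α) * R).trace.re := by
  rw [sum_comm, ← sum_sum_mul_mul_re_trace_mid a P M R]
  exact sum_congr rfl fun β _ => sum_congr rfl fun α _ => by ring

/-- **The frame Hessian form of the quadratic tilt**: with `Z = ∇u(Q) = Σ_α D_α u(Q) Y_α`,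
`Σ_{αβ} D_α u D_β u · D_α D_β Re tr(Q A Qᴴ C) = Re tr(Q Z Z A Qᴴ C) − 2 Re tr(Q Z A Z Qᴴ C) + Re tr(Q A Z Z Qᴴ C)`
(the second derivative of `t ↦ Re tr(Q e^{tZ} A e^{−tZ} Qᴴ C)` at `t = 0`). -/
theorem sum_sum_hess_reTrQuad (A C : Matrix (Fin N) (Fin N) ℂ) (u : Matrix (Fin N) (Fin N) ℂ → ℝ)
    (Q : Matrix (Fin N) (Fin N) ℂ) :
    ∑ α, ∑ β, matD (frame α) u Q * matD (frame β) u Q *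
        matD (frame α) (matD (frame β) (fun Q => (Q * A * Qᴴ * C).trace.re)) Q =
      (Q * frameGrad (dirFun u Q) * frameGrad (dirFun u Q) * A * Qᴴ * C).trace.re
        - 2 * (Q * frameGrad (dirFun u Q) * A * frameGrad (dirFun u Q) * Qᴴ * C).trace.re
        + (Q * A * frameGrad (dirFun u Q) * frameGrad (dirFun u Q) * Qᴴ * C).trace.re := by
  have hZ : frameGrad (dirFun u Q) = ∑ α, matD (frame α) u Q • frame α := by
    simp only [frameGrad, dirFun_apply]
  -- expand the double commutator into four middle-factor terms
  have hexp : ∀ α β, matD (frame α) (matD (frame β) (fun Q => (Q * A * Qᴴ * C).trace.re)) Q =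
      (Q * frame α * 1 * frame β * (A * Qᴴ * C)).trace.re - (Q * frame α * A * frame β * (Qᴴ * C)).trace.re
        - (Q * frame β * A * frame α * (Qᴴ * C)).trace.re + (Q * A * frame β * 1 * frame α * (Qᴴ * C)).trace.re := by
    intro α β
    rw [matD_matD_frame_reTrQuad]
    simp only [Matrix.mul_sub, Matrix.sub_mul, trace_sub, Complex.sub_re, Matrix.mul_one, Matrix.mul_assoc]
    ring
  simp only [hexp, mul_sub, mul_add, sum_add_distrib, sum_sub_distrib]
  have k1 := sum_sum_mul_mul_re_trace_mid (fun α => matD (frame α) u Q) Q 1 (A * Qᴴ * C)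
  have k2 := sum_sum_mul_mul_re_trace_mid (fun α => matD (frame α) u Q) Q A (Qᴴ * C)
  have k3 := sum_sum_mul_mul_re_trace_mid' (fun α => matD (frame α) u Q) Q A (Qᴴ * C)
  have k4 := sum_sum_mul_mul_re_trace_mid' (fun α => matD (frame α) u Q) (Q * A) 1 (Qᴴ * C)
  rw [k1, k2, k3, k4, ← hZ]
  simp only [Matrix.mul_one, Matrix.mul_assoc]
  ring

/-- **Hessian bound for the quadratic tilt**: for unitary `Q, A, C`,
`|Σ_{αβ} D_α u D_β u D_α D_β Re tr(Q A Qᴴ C)| ≤ 4 Γ(u,u)(Q)` — each of the three traces is `≤ ‖Z‖_F²` by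
`|Re tr(X Y)| ≤ ‖X‖_F ‖Y‖_F` and unitary invariance of the Frobenius norm, and `Γ(u,u)(Q) = ‖Z‖_F²`. -/
theorem abs_sum_sum_hess_reTrQuad_le (hN : N ≠ 0) {A C Q : Matrix (Fin N) (Fin N) ℂ}
    (hA : A ∈ Matrix.unitaryGroup (Fin N) ℂ) (hC : C ∈ Matrix.unitaryGroup (Fin N) ℂ)
    (hQ : Q ∈ Matrix.unitaryGroup (Fin N) ℂ) (u : Matrix (Fin N) (Fin N) ℂ → ℝ) :
    |∑ α, ∑ β, matD (frame α) u Q * matD (frame β) u Q *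
        matD (frame α) (matD (frame β) (fun Q => (Q * A * Qᴴ * C).trace.re)) Q| ≤ 4 * Gam u u Q := by
  rw [sum_sum_hess_reTrQuad, Gam_self_eq_frobNorm_sq hN]
  set Z := frameGrad (dirFun u Q) with hZdef
  have hQH : Qᴴ ∈ Matrix.unitaryGroup (Fin N) ℂ := by
    rw [← star_eq_conjTranspose]; exact Unitary.star_mem hQ
  have hQC : Qᴴ * C ∈ Matrix.unitaryGroup (Fin N) ℂ := Submonoid.mul_mem _ hQH hC
  have hAQC : A * (Qᴴ * C) ∈ Matrix.unitaryGroup (Fin N) ℂ := Submonoid.mul_mem _ hA hQC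
  -- the three traces
  have h1 : |(Q * Z * Z * A * Qᴴ * C).trace.re| ≤ frobNorm Z ^ 2 := by
    have e : Q * Z * Z * A * Qᴴ * C = (Q * Z) * (Z * (A * (Qᴴ * C))) := by simp only [Matrix.mul_assoc]
    rw [e]
    calc |((Q * Z) * (Z * (A * (Qᴴ * C)))).trace.re| ≤ frobNorm (Q * Z) * frobNorm (Z * (A * (Qᴴ * C))) :=
          abs_re_trace_mul_le _ _
      _ = frobNorm Z ^ 2 := by rw [frobNorm_unitary_mul hQ, frobNorm_mul_unitary Z hAQC, sq]
  have h2 : |(Q * Z * A * Z * Qᴴ * C).trace.re| ≤ frobNorm Z ^ 2 := by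
    have e : Q * Z * A * Z * Qᴴ * C = (Q * Z) * (A * (Z * (Qᴴ * C))) := by simp only [Matrix.mul_assoc]
    rw [e]
    calc |((Q * Z) * (A * (Z * (Qᴴ * C)))).trace.re| ≤ frobNorm (Q * Z) * frobNorm (A * (Z * (Qᴴ * C))) :=
          abs_re_trace_mul_le _ _
      _ = frobNorm Z ^ 2 := by rw [frobNorm_unitary_mul hQ, frobNorm_unitary_mul hA, frobNorm_mul_unitary Z hQC, sq]
  have h3 : |(Q * A * Z * Z * Qᴴ * C).trace.re| ≤ frobNorm Z ^ 2 := by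
    have e : Q * A * Z * Z * Qᴴ * C = (Q * A * Z) * (Z * (Qᴴ * C)) := by simp only [Matrix.mul_assoc]
    rw [e]
    calc |((Q * A * Z) * (Z * (Qᴴ * C))).trace.re| ≤ frobNorm (Q * A * Z) * frobNorm (Z * (Qᴴ * C)) :=
          abs_re_trace_mul_le _ _
      _ = frobNorm Z ^ 2 := by
          rw [Matrix.mul_assoc Q A Z, frobNorm_unitary_mul hQ, frobNorm_unitary_mul hA, frobNorm_mul_unitary Z hQC, sq]
  have := abs_le.1 h1
  have := abs_le.1 h2
  have := abs_le.1 h3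
  exact abs_le.2 ⟨by linarith, by linarith⟩

/-! ## The curvature-dimension bound for `S = Σᵢ cᵢ Re tr(Q Aᵢ Qᴴ Cᵢ)` -/

/-- The frame Hessian of the sum potential is the sum of the frame Hessians. -/
theorem matD_matD_sum_reTrQuad {ι : Type*} (s : Finset ι) (c : ι → ℝ) (A C : ι → Matrix (Fin N) (Fin N) ℂ)
    (α β : FrameIdx N) (Q : Matrix (Fin N) (Fin N) ℂ) :
    matD (frame α) (matD (frame β) (fun Q => ∑ i ∈ s, c i * (Q * A i * Qᴴ * C i).trace.re)) Q =
      ∑ i ∈ s, c i * matD (frame α) (matD (frame β) (fun Q => (Q * A i * Qᴴ * C i).trace.re)) Q := by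
  rw [matD_sum s (fun i _ => contDiff_const_mul_reTrQuad (c i) (A i) (C i))]
  have h1 : ∀ i, matD (frame β) (fun Q => c i * (Q * A i * Qᴴ * C i).trace.re) =
      fun Q => c i * matD (frame β) (fun Q => (Q * A i * Qᴴ * C i).trace.re) Q := fun i =>
    matD_const_mul (contDiff_reTrQuad (A i) (C i)) (c i) _
  simp only [h1]
  rw [matD_sum s (fun i _ => contDiff_const.mul (contDiff_matD (contDiff_reTrQuad (A i) (C i)) _))]
  refine sum_congr rfl fun i _ => ?_
  rw [matD_const_mul (contDiff_matD (contDiff_reTrQuad (A i) (C i)) _)]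

/-- **Bakry–Émery curvature bound for quadratic one-link tilts.** For `S(Q) = Σᵢ cᵢ Re tr(Q Aᵢ Qᴴ Cᵢ)` with `Aᵢ, Cᵢ`
unitary and `Q` unitary: `Γ₂^S(u)(Q) ≥ (N/2 − 4 Σᵢ |cᵢ|) Γ(u,u)(Q)` for every smooth `u` (`Ric_{SU(N)} = N/2` in the
Hilbert–Schmidt metric, tree `sum_sum_sq_comm_matD`, and the Hessian bound `abs_sum_sum_hess_reTrQuad_le`).  This is the
hypothesis `hCD` of `poincare_of_cd` with `K = N/2 − 4 Σᵢ |cᵢ|`. -/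
theorem Gam2_quadTilt_ge (hN : N ≠ 0) {ι : Type*} (s : Finset ι) (c : ι → ℝ) {A C : ι → Matrix (Fin N) (Fin N) ℂ}
    (hA : ∀ i ∈ s, A i ∈ Matrix.unitaryGroup (Fin N) ℂ) (hC : ∀ i ∈ s, C i ∈ Matrix.unitaryGroup (Fin N) ℂ)
    {u : Matrix (Fin N) (Fin N) ℂ → ℝ} (hu : ContDiff ℝ ∞ u) {Q : Matrix (Fin N) (Fin N) ℂ}
    (hQ : Q ∈ Matrix.unitaryGroup (Fin N) ℂ) :
    ((N : ℝ) / 2 - 4 * ∑ i ∈ s, |c i|) * Gam u u Q ≤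
      Gam2 (fun Q => ∑ i ∈ s, c i * (Q * A i * Qᴴ * C i).trace.re) u Q := by
  rw [Gam2_eq hN (contDiff_sum_reTrQuad s c A C) hu]
  simp only [matD_matD_sum_reTrQuad]
  -- Ricci term
  have hRic : (N : ℝ) / 2 * Gam u u Q ≤ ∑ α, ∑ β, matD (frame α) (matD (frame β) u) Q ^ 2 := by
    have h1 := sum_sum_sq_sub_swap_le (fun α β => matD (frame α) (matD (frame β) u) Q)
    rw [sum_sum_sq_comm_matD hN hu Q] at h1
    linarith
  -- Hessian term: swap the sums and bound termwise
  have hswap : ∑ α, ∑ β, matD (frame α) u Q * matD (frame β) u Q *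
      ∑ i ∈ s, c i * matD (frame α) (matD (frame β) (fun Q => (Q * A i * Qᴴ * C i).trace.re)) Q =
      ∑ i ∈ s, c i * ∑ α, ∑ β, matD (frame α) u Q * matD (frame β) u Q *
        matD (frame α) (matD (frame β) (fun Q => (Q * A i * Qᴴ * C i).trace.re)) Q := by
    symm
    calc ∑ i ∈ s, c i * ∑ α, ∑ β, matD (frame α) u Q * matD (frame β) u Q *
          matD (frame α) (matD (frame β) (fun Q => (Q * A i * Qᴴ * C i).trace.re)) Q
        = ∑ i ∈ s, ∑ α, ∑ β, c i * (matD (frame α) u Q * matD (frame β) u Q *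
            matD (frame α) (matD (frame β) (fun Q => (Q * A i * Qᴴ * C i).trace.re)) Q) := by
          simp only [Finset.mul_sum]
      _ = ∑ α, ∑ i ∈ s, ∑ β, c i * (matD (frame α) u Q * matD (frame β) u Q *
            matD (frame α) (matD (frame β) (fun Q => (Q * A i * Qᴴ * C i).trace.re)) Q) := Finset.sum_comm
      _ = ∑ α, ∑ β, ∑ i ∈ s, c i * (matD (frame α) u Q * matD (frame β) u Q *
            matD (frame α) (matD (frame β) (fun Q => (Q * A i * Qᴴ * C i).trace.re)) Q) :=
          sum_congr rfl fun α _ => Finset.sum_comm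
      _ = _ := by
          refine sum_congr rfl fun α _ => sum_congr rfl fun β _ => ?_
          rw [Finset.mul_sum]
          exact sum_congr rfl fun i _ => by ring
  rw [hswap]
  have hHess : |∑ i ∈ s, c i * ∑ α, ∑ β, matD (frame α) u Q * matD (frame β) u Q *
      matD (frame α) (matD (frame β) (fun Q => (Q * A i * Qᴴ * C i).trace.re)) Q| ≤
      (∑ i ∈ s, |c i|) * (4 * Gam u u Q) := by
    rw [Finset.sum_mul]
    refine (abs_sum_le_sum_abs _ _).trans (sum_le_sum fun i hi => ?_)
    rw [abs_mul]
    exact mul_le_mul_of_nonneg_left (abs_sum_sum_hess_reTrQuad_le hN (hA i hi) (hC i hi) hQ u) (abs_nonneg _)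
  have hHess' := (abs_le.1 hHess).2
  nlinarith [hRic, hHess', Gam_self_nonneg u Q]

/-- The curvature bound on `SU(N)` in the shape of the hypothesis `hCD` of `poincare_of_cd`. -/
theorem cd_quadTilt (hN : N ≠ 0) {ι : Type*} (s : Finset ι) (c : ι → ℝ) {A C : ι → Matrix (Fin N) (Fin N) ℂ}
    (hA : ∀ i ∈ s, A i ∈ Matrix.unitaryGroup (Fin N) ℂ) (hC : ∀ i ∈ s, C i ∈ Matrix.unitaryGroup (Fin N) ℂ) :
    ∀ u : Matrix (Fin N) (Fin N) ℂ → ℝ, ContDiff ℝ ∞ u → ∀ g : SUN N,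
      ((N : ℝ) / 2 - 4 * ∑ i ∈ s, |c i|) * Gam u u (g : Matrix (Fin N) (Fin N) ℂ) ≤
        Gam2 (fun Q => ∑ i ∈ s, c i * (Q * A i * Qᴴ * C i).trace.re) u (g : Matrix (Fin N) (Fin N) ℂ) :=
  fun _ hu g => Gam2_quadTilt_ge hN s c hA hC hu (SUN.mem_unitaryGroup g)

end Summit.QuantumFields.YangMills.Theorems.EguchiKawaiDirectionLadder
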